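import Mathlib.AlgebraicGeometry.Pullbacks
import Mathlib.AlgebraicGeometry.PullbackCarrier
import Mathlib.AlgebraicGeometry.AffineScheme
import Mathlib.CategoryTheory.Monoidal.Cartesian.Over
import Mathlib.RingTheory.Kaehler.TensorProduct
import Mathlib.RingTheory.Localization.Module
import Mathlib.RingTheory.Etale.Kaehler
import HarnessLib

/-!
# The product affine chart `V₁ × V₂ ≅ Spec (Γ(V₁) ⊗ Γ(V₂))` of a fibre product of `K`-schemes,
# and the relative Kähler basis `1 ⊗ d yᵢ`

Topic `Literature/AlgebraicGeometry/Motives` (proofs only; no definitions, no named facts).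
For `K`-schemes `E₁, E₂` (objects of `Over (Spec K)`, product `E₁ ⊗ E₂` = Mathlib's fibre product
`pullback E₁.hom E₂.hom`, `Over.tensorObj_left`) and affine opens `Vᵢ ⊆ Eᵢ` whose rings of
sections are given `K`-algebra structures compatible with the structure morphisms:

* `fromSpec_comp_hom_eq_SpecMap_algebraMap` — `Spec Γ(V) → E → Spec K` is `Spec` of the structure map `K → Γ(V)`
  (Mathlib `IsAffineOpen.SpecMap_appLE_fromSpec`, `fromSpec_top`, `isoSpec_Spec_inv`);
* `exists_productChart` — **the product chart**: an OPEN IMMERSION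
  `c : Spec (Γ(V₁) ⊗_K Γ(V₂)) → (E₁ ⊗ E₂).left` with image `pr₁⁻¹ V₁ ∩ pr₂⁻¹ V₂` and with
  `c ≫ pr₁ = Spec (includeLeft) ≫ (Spec Γ(V₁) → E₁)`, `c ≫ pr₂ = Spec (includeRight) ≫ (Spec Γ(V₂) → E₂)`
  (Hartshorne II Thm. 3.3, Step 1–3: the fibre product of affines is `Spec` of the tensor product,
  and fibre products are local on the factors; Mathlib `pullbackSpecIso`, `pullback.map`,
  `Scheme.Pullback.range_map`);
* `exists_basis_kaehler_tensor_eq_D` (ring form) — **relative coordinates on the product**: an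
  exact basis `d yᵢ` of `Ω[A₂⁄K]` gives the exact basis `d (1 ⊗ yᵢ)` of `Ω[(A₁ ⊗_K A₂)⁄A₁]`
  (Mathlib `KaehlerDifferential.tensorKaehlerEquiv`: `Ω` commutes with base change), and
  `exists_basis_kaehler_tensor_localization_eq_D` — the same for any localisation of `A₁ ⊗_K A₂`
  (e.g. the stalks of `E₁ ⊗ E₂` at the points of the chart, or its function field).

This is the chart in which relative top forms on `E × E → E` (Bosch–Lütkebohmert–Raynaud,
*Néron Models*, §4.2, the form `pr₂^* ω`; Edixhoven–Romagny §6, proof of Thm. 6.3, «`ω'` the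
pullback of `ω` via the projection») are computed. Cell `hodgecm-mathlib`, road W of `r₀` ((W0),
node PC of `B-provers/B-p18/W0-SPEC.md`).

## Sources

* R. Hartshorne, *Algebraic Geometry*, GTM 52, II Thm. 3.3 (construction of fibre products,
  Steps 1–3). [Hartshorne1977]
* S. Bosch, W. Lütkebohmert, M. Raynaud, *Néron Models*, Springer 1990, §2.1 Prop. 3 (base change
  of differentials), §4.2. [BLRNeronModels1990]
-/

noncomputable section

universe u

namespace Literature.AlgebraicGeometry.Motives

open CategoryTheory Limits _root_.AlgebraicGeometry MonoidalCategory CartesianMonoidalCategory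
open TensorProduct

/-! ### Ring form: relative exact Kähler bases on a tensor product and its localisations -/

section Ring

variable (K A₁ A₂ : Type u) [CommRing K] [CommRing A₁] [CommRing A₂] [Algebra K A₁] [Algebra K A₂]

/-- **Relative coordinates on a product** (Bosch–Lütkebohmert–Raynaud §2.1 Prop. 3: `Ω` commutes
with base change): if `d y₁, …, d yₙ` is a basis of `Ω[A₂⁄K]`, then `d (1 ⊗ y₁), …, d (1 ⊗ yₙ)` is a
basis of `Ω[(A₁ ⊗_K A₂)⁄A₁]` (Mathlib `KaehlerDifferential.tensorKaehlerEquiv` for the pushout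
square `K → A₁`, `A₂ → A₁ ⊗_K A₂`). [cite: BLRNeronModels1990, §2.1 Prop. 3] -/
theorem exists_basis_kaehler_tensor_eq_D {ι : Type*} {y : ι → A₂}
    (b : Module.Basis ι A₂ Ω[A₂⁄K]) (hb : ∀ i, b i = KaehlerDifferential.D K A₂ (y i)) :
    ∃ b' : Module.Basis ι (A₁ ⊗[K] A₂) Ω[(A₁ ⊗[K] A₂)⁄A₁],
      ∀ i, b' i = KaehlerDifferential.D A₁ (A₁ ⊗[K] A₂) (1 ⊗ₜ y i) := by
  letI : Algebra A₂ (A₁ ⊗[K] A₂) := Algebra.TensorProduct.rightAlgebra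
  let e := KaehlerDifferential.tensorKaehlerEquiv K A₁ A₂ (A₁ ⊗[K] A₂)
  refine ⟨(b.baseChange (A₁ ⊗[K] A₂)).map e, fun i => ?_⟩
  rw [Module.Basis.map_apply, Module.Basis.baseChange_apply, hb,
    KaehlerDifferential.tensorKaehlerEquiv_tmul_D, one_smul]
  rfl

/-- The same after any localisation `T` of `A₁ ⊗_K A₂` (as an `A₁`-algebra through the left factor):
`d (1 ⊗ yᵢ)` is a basis of `Ω[T⁄A₁]` (`Ω` commutes with localisation). [cite: BLRNeronModels1990, §2.1 Prop. 3] -/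
theorem exists_basis_kaehler_tensor_localization_eq_D {ι : Type*} {y : ι → A₂}
    (b : Module.Basis ι A₂ Ω[A₂⁄K]) (hb : ∀ i, b i = KaehlerDifferential.D K A₂ (y i))
    (T : Type u) [CommRing T] [Algebra (A₁ ⊗[K] A₂) T] [Algebra A₁ T]
    [IsScalarTower A₁ (A₁ ⊗[K] A₂) T] (M : Submonoid (A₁ ⊗[K] A₂)) [IsLocalization M T] :
    ∃ b' : Module.Basis ι T Ω[T⁄A₁],
      ∀ i, b' i = KaehlerDifferential.D A₁ T (algebraMap (A₁ ⊗[K] A₂) T (1 ⊗ₜ y i)) := by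
  obtain ⟨b₁, hb₁⟩ := exists_basis_kaehler_tensor_eq_D K A₁ A₂ b hb
  refine ⟨b₁.ofIsLocalizedModule T M (KaehlerDifferential.map A₁ A₁ (A₁ ⊗[K] A₂) T), fun i => ?_⟩
  rw [Module.Basis.ofIsLocalizedModule_apply, hb₁, KaehlerDifferential.map_D]

end Ring

/-! ### The product affine chart -/

section Chart

variable {K : Type u} [CommRing K] (E₁ E₂ : Over (Spec (.of K)))
  {V₁ : E₁.left.Opens} (hV₁ : IsAffineOpen V₁) {V₂ : E₂.left.Opens} (hV₂ : IsAffineOpen V₂)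
  [Algebra K Γ(E₁.left, V₁)] [Algebra K Γ(E₂.left, V₂)]

/-- **`Spec Γ(V) → E → Spec K` is `Spec` of the structure map**, when the `K`-algebra structure of
`Γ(E, V)` is the one induced by the structure morphism (`K = Γ(Spec K) → Γ(E, ⊤) → Γ(E, V)`).
[cite: Hartshorne1977, II Thm. 3.3 (Step 1)] -/
theorem fromSpec_comp_hom_eq_SpecMap_algebraMap {E : Over (Spec (.of K))} {V : E.left.Opens} (hV : IsAffineOpen V)
    [Algebra K Γ(E.left, V)]
    (h : algebraMap K Γ(E.left, V) = ((Scheme.ΓSpecIso (.of K)).inv ≫ E.hom.appLE ⊤ V le_top).hom) :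
    hV.fromSpec ≫ E.hom = Spec.map (CommRingCat.ofHom (algebraMap K Γ(E.left, V))) := by
  rw [h, CommRingCat.ofHom_hom, Spec.map_comp, ← Scheme.isoSpec_Spec_inv,
    ← IsAffineOpen.fromSpec_top]
  exact (IsAffineOpen.SpecMap_appLE_fromSpec E.hom (isAffineOpen_top _) hV le_top).symm

include hV₁ hV₂ in
/-- **The product affine chart** (Hartshorne II Thm. 3.3, Steps 1–3): for affine opens `V₁ ⊆ E₁`,
`V₂ ⊆ E₂` of `K`-schemes (sections with the induced `K`-algebra structures) there is an open
immersion `c : Spec (Γ(V₁) ⊗_K Γ(V₂)) → E₁ ×_K E₂` with image `pr₁⁻¹ V₁ ∩ pr₂⁻¹ V₂`, under which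
the two projections are `Spec` of `includeLeft` / `includeRight` followed by the charts
`Spec Γ(Vᵢ) → Eᵢ`. [cite: Hartshorne1977, II Thm. 3.3] -/
theorem exists_productChart
    (h₁ : algebraMap K Γ(E₁.left, V₁) = ((Scheme.ΓSpecIso (.of K)).inv ≫ E₁.hom.appLE ⊤ V₁ le_top).hom)
    (h₂ : algebraMap K Γ(E₂.left, V₂) = ((Scheme.ΓSpecIso (.of K)).inv ≫ E₂.hom.appLE ⊤ V₂ le_top).hom) :
    ∃ c : Spec (.of (Γ(E₁.left, V₁) ⊗[K] Γ(E₂.left, V₂))) ⟶ (E₁ ⊗ E₂).left,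
      IsOpenImmersion c ∧
      Set.range c = (fst E₁ E₂).left ⁻¹' (V₁ : Set E₁.left) ∩ (snd E₁ E₂).left ⁻¹' (V₂ : Set E₂.left) ∧
      c ≫ (fst E₁ E₂).left =
        Spec.map (CommRingCat.ofHom Algebra.TensorProduct.includeLeftRingHom) ≫ hV₁.fromSpec ∧
      c ≫ (snd E₁ E₂).left =
        Spec.map (CommRingCat.ofHom (Algebra.TensorProduct.includeRight (R := K)
          (A := Γ(E₁.left, V₁)) (B := Γ(E₂.left, V₂))).toRingHom) ≫ hV₂.fromSpec := by
  have e₁ : Spec.map (CommRingCat.ofHom (algebraMap K Γ(E₁.left, V₁))) ≫ 𝟙 (Spec (.of K)) =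
      hV₁.fromSpec ≫ E₁.hom := by rw [Category.comp_id, fromSpec_comp_hom_eq_SpecMap_algebraMap hV₁ h₁]
  have e₂ : Spec.map (CommRingCat.ofHom (algebraMap K Γ(E₂.left, V₂))) ≫ 𝟙 (Spec (.of K)) =
      hV₂.fromSpec ≫ E₂.hom := by rw [Category.comp_id, fromSpec_comp_hom_eq_SpecMap_algebraMap hV₂ h₂]
  let c : Spec (.of (Γ(E₁.left, V₁) ⊗[K] Γ(E₂.left, V₂))) ⟶ (E₁ ⊗ E₂).left :=
    (pullbackSpecIso K Γ(E₁.left, V₁) Γ(E₂.left, V₂)).inv ≫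
      pullback.map _ _ E₁.hom E₂.hom hV₁.fromSpec hV₂.fromSpec (𝟙 _) e₁ e₂
  have hc : IsOpenImmersion c :=
    inferInstanceAs (IsOpenImmersion ((pullbackSpecIso K _ _).inv ≫ pullback.map _ _ _ _ _ _ _ e₁ e₂))
  refine ⟨c, hc, ?_, ?_, ?_⟩
  · change Set.range ((pullbackSpecIso K _ _).inv ≫ pullback.map _ _ _ _ _ _ _ e₁ e₂) = _
    have hsurj : Function.Surjective (pullbackSpecIso K Γ(E₁.left, V₁) Γ(E₂.left, V₂)).inv :=
      (Scheme.homeoOfIso (pullbackSpecIso K Γ(E₁.left, V₁) Γ(E₂.left, V₂)).symm).surjective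
    rw [Scheme.Hom.comp_base, TopCat.coe_comp, hsurj.range_comp,
      Scheme.Pullback.range_map, IsAffineOpen.range_fromSpec, IsAffineOpen.range_fromSpec]
    rfl
  · change ((pullbackSpecIso K _ _).inv ≫ pullback.map _ _ _ _ _ _ _ e₁ e₂) ≫ pullback.fst _ _ = _
    rw [Category.assoc, pullback.lift_fst, ← Category.assoc, pullbackSpecIso_inv_fst]
  · change ((pullbackSpecIso K _ _).inv ≫ pullback.map _ _ _ _ _ _ _ e₁ e₂) ≫ pullback.snd _ _ = _
    rw [Category.assoc, pullback.lift_snd, ← Category.assoc, pullbackSpecIso_inv_snd]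
    rfl

end Chart

end Literature.AlgebraicGeometry.Motives

end
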